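import Literature.MathematicalPhysics.QuantumFieldTheory.Balaban1983to89.B9Thm31SiteCoerciveGaugeBlockY
import Literature.MathematicalPhysics.QuantumFieldTheory.Balaban1983to89.B9Thm31SiteCoerciveTaxiBlockY
import Literature.MathematicalPhysics.QuantumFieldTheory.Balaban1983to89.B9Thm31SiteCoerciveReg335CubeY

/-!
# `Balaban1983to89.B9Thm31SiteCoerciveReg335BlockY` — T. Bałaban, *Propagators for lattice gauge theories in a background field*, Commun. Math.
# Phys. **99** (1985) 389–434 [Balaban1985BackgroundPropagators] Thm 3.1 p. 397 ∕ Thm 3.11 p. 416 with (3.35) p. 396, (3.24) p. 394: THE PER-BLOCK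
# COERCIVITY OF def-Y's `Δ′_a(U)` ON THE (3.35) CLASS — one block's share of (3.24)'s form at a background `U ∈ (bg9K (M_N ℂ) G i).Reg335 c α₀` is
# bounded below by `(½·min(2∕((n−1)n), κn^{d+1}) − 4(d+1)ρ_j² − 4κn^{d+1}ρ′_j²)·Σ_{z∈s}HS(Φ z)`, `ρ_j = e^{C·L^{−j}} − 1`, `ρ′_j = (d+1)(n−1)ρ_j`,
# `C = c·M·α₀`, `n = Lʲ` (file 3b of the site-operator coercivity set; file 3c sums over `𝔅`)

statement-level skeleton of published theorems with citation tags; proofs where landed; nothing here is a claim about the Yang–Mills mass gap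

THE PRINT (verbatim).  Thm 3.11 p. 416: *«The proof can be reduced to a proof of positivity of the operators G_□ … Doing the gauge transformation we get
U = e^{iηA} with A small … G_□(e^{iηA}) = G_□(1)(I − V(A)G_□(1))⁻¹. In [4] we have proved that the operator G_□(1) is positive»*; (3.35) p. 396:
*«U^u = e^{iηA}. and … |A| < O(1)Mα₀(Lʲη)⁻¹ … on □»*.

WHY THIS FILE (cell `pub-ymgap`, Track A node N06 [B9], width seat `pub-ymgap-dag-n06-w1`, OFFER-A).  It COMPOSES the three previous files at def-Y's
record: file 2's per-block bound `block_form_ge_of_gauge` (any gauge, any `IsGaugeLawS` table) at the table of record `parSymY` (`parSymY_isGaugeLawS`),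
with the gauge `u` of file 3a (`exists_gauge_of_reg335_blk`: the (3.35) datum of the big cube of the block; every bond with both ends in the cube is
`ρ_j`-close to `1` and a contraction pair) and the block-transporter letter `ρ′_j` from file 2b (`parTaxiV_near_one_of_box`: on the corner leg
`U^u(Γ_{c_s,z})` def-Y's taxicab contour runs forward inside the block's coordinate box, `≤ (d+1)(n−1)` bonds, all with both ends in the block ⊂ the cube).
What remains displayed is NOTHING about `U` beyond membership in def-Y's class: the smallness is now the explicit function `ρ_j` of `C = c·M·α₀`.

WHAT IS PROVED (sorry-free; 0 `def`; [folklore] bookkeeping over files 2, 2b, 3a; nothing of [B9] asserted beyond the composition).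
* §1 residues on the block: `val_symm_sub_symm_corner` (`((sym z)_μ − (sym c)_μ) mod N = z_μ − c_μ`), `two_mul_side_le_N0`, `val_of_box`
  (a point of the residue box of `(c, z)` has chart coordinates in `[c, z]`), `mem_bigCube_of_box` ∕ `shift_mem_bigCube_of_box`.
* §2 ★★★ `block_form_ge_reg335` — THE PER-BLOCK COERCIVITY ON THE CLASS (statement in the title), `G ≤ U(N)`, `N ≥ 1`, `0 ≤ c·M·α₀`, `0 ≤ κ`.
HONEST SCOPE.  A composition; no estimate of [B9] asserted; NOT a node discharge, NOT summit progress; count-neutral; one finite lattice at a time; nothing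
continuum ∕ OS ∕ mass gap ∕ Clay.
-/

noncomputable section

namespace Literature.MathematicalPhysics.QuantumFieldTheory.Balaban1983to89.B9Thm31SiteCoerciveReg335BlockY

open Literature.MathematicalPhysics.QuantumFieldTheory.Balaban1983to89
open Node00 B6KLevelCensusIndexV1 B6Geom246MultiLevelBox B6MultiLevelBoxOperator B6MultiLevelTorusOperator B6GlobalChartV1 B9BackgroundsKLevelV1
  B9Eq39Adjoint B9Thm311DeltaPrimePos B9Thm31SiteCoerciveGaugeBlockY B9Thm31SiteCoerciveTaxiBlockY B9Thm31SiteCoerciveReg335CubeY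
open Literature.MathematicalPhysics.QuantumFieldTheory.Balaban1983to89.B4Reflection242 (boxDom blk mem_boxDom)
open Literature.MathematicalPhysics.QuantumFieldTheory.Balaban1983to89.B4Lower18 (RBond rsrc rtgt)
open scoped Matrix Matrix.Norms.L2Operator

variable {d ℓ : ℕ} {hd : 1 ≤ d + 1} {hL : Odd (ℓ + 1) ∧ 1 < ℓ + 1} {b₀ b₁ : ℝ}

/-! ## §1 Residues on the block -/

section Residues

variable (i : KIdx d ℓ hd hL b₀ b₁)

/-- on a block, the residue differences to the corner ARE the coordinate differences: `((sym z)_μ − (sym c)_μ) mod N = z_μ − c_μ`.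
[cite: Balaban1985BackgroundPropagators, (3.19) p.393, dictionary] -/
theorem val_symm_sub_symm_corner {z : SiteY i} {s : BlkY i} (h : blkOf i.D.toDomains z = s) (μ : Fin (d + 1)) :
    ((((boxEquiv i.hN).symm z μ - (boxEquiv i.hN).symm (blkCornerY i s) μ).val : ℕ) : ℤ) = z.1 μ - (blkCornerY i s).1 μ := by
  have hz := val_boxEquiv_symm i.hN z μ
  have hc := val_boxEquiv_symm i.hN (blkCornerY i s) μ
  have hle : ((boxEquiv i.hN).symm (blkCornerY i s) μ).val ≤ ((boxEquiv i.hN).symm z μ).val := by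
    have := (coord_bounds_of_blkOf i h μ).1
    rw [← hz, ← hc] at this
    exact_mod_cast this
  rw [ZMod.val_sub hle]
  push_cast [hle]
  rw [hz, hc]

/-- `2(n − 1) ≤ 2n ≤ N₀`: the block is less than half a period wide. [cite: Balaban1984PropagatorsII, (2.1) p.224, bookkeeping] -/
theorem two_mul_side_le_N0 (s : BlkY i) (μ : Fin (d + 1)) : 2 * (ℓ + 1) ^ s.1.1 ≤ N0 ℓ i.Mh i.k i.P' μ := by
  have hjk : s.1.1 ≤ i.k := (scale_bounds i.D.toDomains s).2
  have hpow : (ℓ + 1) ^ s.1.1 ≤ (ℓ + 1) ^ i.k := Nat.pow_le_pow_right (Nat.succ_pos ℓ) hjk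
  have hM : 8 ≤ i.Mh := i.hM8
  have hP : 5 ≤ i.P' μ := i.hP5 μ
  show 2 * (ℓ + 1) ^ s.1.1 ≤ (ℓ + 1) ^ i.k * ((ℓ + 1) * (i.Mh * i.P' μ))
  have h1 : 2 ≤ (ℓ + 1) * (i.Mh * i.P' μ) :=
    calc 2 ≤ 1 * (8 * 5) := by norm_num
      _ ≤ (ℓ + 1) * (i.Mh * i.P' μ) := Nat.mul_le_mul (by omega) (Nat.mul_le_mul hM hP)
  calc 2 * (ℓ + 1) ^ s.1.1 = (ℓ + 1) ^ s.1.1 * 2 := by ring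
    _ ≤ (ℓ + 1) ^ i.k * ((ℓ + 1) * (i.Mh * i.P' μ)) := Nat.mul_le_mul hpow h1

/-- a point `y` of the residue box of `(sym c, sym z)` (`(y_ν − (sym c)_ν) mod N ≤ (z_ν − c_ν)`) has chart coordinates `c_ν + ((y_ν − (sym c)_ν) mod N)`.
[cite: Balaban1985BackgroundPropagators, (3.19) p.393, dictionary] -/
theorem val_of_box {s : BlkY i} {y : Site (PV d ℓ i.m i.K hd hL) 0} (ν : Fin (d + 1)) {t : ℕ}
    (ht : (y ν - (boxEquiv i.hN).symm (blkCornerY i s) ν).val + t < (ℓ + 1) ^ s.1.1) :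
    (((y ν + (t : ZMod ((PV d ℓ i.m i.K hd hL).sitesPerDir 0))).val : ℕ) : ℤ)
      = (blkCornerY i s).1 ν + (y ν - (boxEquiv i.hN).symm (blkCornerY i s) ν).val + t := by
  have hc := val_boxEquiv_symm i.hN (blkCornerY i s) ν
  have hbig := corner_add_side_le_big i s ν
  have hN0 := bigCorner_add_side_le_N0 i s ν
  have hNN : N0 ℓ i.Mh i.k i.P' ν = (PV d ℓ i.m i.K hd hL).sitesPerDir 0 := i.hN ν
  have e : y ν + (t : ZMod ((PV d ℓ i.m i.K hd hL).sitesPerDir 0))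
      = (boxEquiv i.hN).symm (blkCornerY i s) ν + ((y ν - (boxEquiv i.hN).symm (blkCornerY i s) ν) + (t : ZMod _)) := by abel
  have hn' : (((ℓ + 1) ^ s.1.1 : ℕ) : ℤ) = ((ℓ : ℤ) + 1) ^ s.1.1 := by push_cast; ring
  have hNN' : ((N0 ℓ i.Mh i.k i.P' ν : ℕ) : ℤ) = (((PV d ℓ i.m i.K hd hL).sitesPerDir 0 : ℕ) : ℤ) := by exact_mod_cast hNN
  have hlt : ((boxEquiv i.hN).symm (blkCornerY i s) ν).val + ((y ν - (boxEquiv i.hN).symm (blkCornerY i s) ν).val + t)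
      < (PV d ℓ i.m i.K hd hL).sitesPerDir 0 := by
    zify at ht ⊢
    rw [hc, ← hNN']
    linarith
  have hlt2 : (y ν - (boxEquiv i.hN).symm (blkCornerY i s) ν).val + t < (PV d ℓ i.m i.K hd hL).sitesPerDir 0 := by omega
  have hval2 : ((y ν - (boxEquiv i.hN).symm (blkCornerY i s) ν) + (t : ZMod _)).val = (y ν - (boxEquiv i.hN).symm (blkCornerY i s) ν).val + t := by
    rw [ZMod.val_add, ZMod.val_natCast, Nat.add_mod_mod, Nat.mod_eq_of_lt hlt2]
  rw [e, ZMod.val_add, hval2, Nat.mod_eq_of_lt hlt]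
  push_cast
  rw [hc]
  ring

/-- a point of the residue box of `(sym c, sym z)`, advanced by `t` steps in direction `ν` with `(y_ν − (sym c)_ν) mod N + t < n` and by nothing elsewhere, lies in
the big cube of the block. [cite: Balaban1985BackgroundPropagators, (3.19) p.393, p.396 (the cube class), dictionary] -/
theorem mem_bigCube_of_box {z : SiteY i} {s : BlkY i} (h : blkOf i.D.toDomains z = s) {y : Site (PV d ℓ i.m i.K hd hL) 0}
    (hy : ∀ ν, (y ν - (boxEquiv i.hN).symm (blkCornerY i s) ν).val ≤ ((boxEquiv i.hN).symm z ν - (boxEquiv i.hN).symm (blkCornerY i s) ν).val)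
    (μ : Fin (d + 1)) (t : ℕ) (ht : (y μ - (boxEquiv i.hN).symm (blkCornerY i s) μ).val + t < (ℓ + 1) ^ s.1.1) :
    Function.update y μ (y μ + (t : ZMod ((PV d ℓ i.m i.K hd hL).sitesPerDir 0)))
      ∈ torusCube (fun μ => (((((bigSide ℓ i.Mh s.1.1 : ℕ) : ℤ) * blk (bigSide ℓ i.Mh s.1.1) (blkCornerY i s).1 μ).toNat : ℕ) :
          ZMod ((PV d ℓ i.m i.K hd hL).sitesPerDir 0))) (bigSide ℓ i.Mh s.1.1) := by
  refine mem_bigCube_of_coord_bounds i s _ fun ν => ?_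
  have hcC : ((bigSide ℓ i.Mh s.1.1 : ℕ) : ℤ) * blk (bigSide ℓ i.Mh s.1.1) (blkCornerY i s).1 ν ≤ (blkCornerY i s).1 ν :=
    (bigCoord_bounds_of_blkOf i (blkOf_corner i.D.toDomains s) ν).1
  have hbig := corner_add_side_le_big i s ν
  have hn' : (((ℓ + 1) ^ s.1.1 : ℕ) : ℤ) = ((ℓ : ℤ) + 1) ^ s.1.1 := by push_cast; ring
  have hδ : ((((boxEquiv i.hN).symm z ν - (boxEquiv i.hN).symm (blkCornerY i s) ν).val : ℕ) : ℤ) = z.1 ν - (blkCornerY i s).1 ν :=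
    val_symm_sub_symm_corner i h ν
  have hzν := (coord_bounds_of_blkOf i h ν).2
  have hyν := hy ν
  zify at hyν
  rw [hδ] at hyν
  by_cases hν : ν = μ
  · subst hν
    rw [Function.update_self]
    have hv := val_of_box i ν (s := s) (y := y) (t := t) ht
    rw [hv]
    zify at ht
    constructor <;> linarith
  · rw [Function.update_of_ne hν]
    have ht0 : (y ν - (boxEquiv i.hN).symm (blkCornerY i s) ν).val + 0 < (ℓ + 1) ^ s.1.1 := by
      zify; linarith
    have hv := val_of_box i ν (s := s) (y := y) (t := 0) ht0
    simp only [Nat.cast_zero, add_zero] at hv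
    rw [hv]
    constructor <;> linarith

end Residues

/-! ## §2 The per-block coercivity on the class -/

section Block

variable (i : KIdx d ℓ hd hL b₀ b₁) {N : ℕ} {G : Subgroup (Matrix (Fin N) (Fin N) ℂ)ˣ}

/-- ★★★ **THE PER-BLOCK COERCIVITY OF def-Y's `Δ′_a(U)` ON THE (3.35) CLASS**: for `G ≤ U(N)`, `N ≥ 1`, `U ∈ (bg9K (M_N ℂ) G i).Reg335 c α₀` with
`0 ≤ C := c·M·α₀`, a block `s ∈ 𝔅` of level `j` (`n = Lʲ`), `κ ≥ 0`, and `ρ := e^{C·L^{−j}} − 1`, `ρ′ := (d+1)(n−1)ρ`: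
`(½·min(2∕((n−1)n), κn^{d+1}) − 4(d+1)ρ² − 4κn^{d+1}ρ′²)·Σ_{z∈s} HS(Φ z) ≤ Σ_{bonds⊂s} HS((∇_UΦ)(b)) + κ·HS(blkSumY i (parSymY i) U Φ s)`.
[cite: Balaban1985BackgroundPropagators, Thm 3.11 p.416, Thm 3.1 p.397, (3.24) p.394, (3.35) p.396; Balaban1984PropagatorsII, (2.14) p.225] -/
theorem block_form_ge_reg335 [Nonempty (Fin N)] (hG : G ≤ B7Prop2Explicit.unitaryUnits (Matrix (Fin N) (Fin N) ℂ))
    {U : CfgY (Matrix (Fin N) (Fin N) ℂ) i} {c α₀ : ℝ} (hC : 0 ≤ c * (kGeo i).M * α₀)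
    (hreg : (bg9K (Matrix (Fin N) (Fin N) ℂ) G i).Reg335 c α₀ U) {κ : ℝ} (hκ : 0 ≤ κ) (s : BlkY i)
    (Φ : SiteY i → Matrix (Fin N) (Fin N) ℂ) :
    ((1 / 2 : ℝ) * min (1 / (((((ℓ + 1) ^ s.1.1 : ℕ) : ℝ) - 1) * (((ℓ + 1) ^ s.1.1 : ℕ) : ℝ) / 2)) (κ * (((ℓ + 1) ^ s.1.1 : ℕ) : ℝ) ^ (d + 1))
        - 4 * ((d : ℝ) + 1) * (Real.exp ((c * (kGeo i).M * α₀) * ((((ℓ + 1 : ℕ) : ℝ) ^ s.1.1)⁻¹)) - 1) ^ 2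
        - 4 * κ * (((ℓ + 1) ^ s.1.1 : ℕ) : ℝ) ^ (d + 1) *
          ((((d + 1 : ℕ) : ℝ)) * (((((ℓ + 1) ^ s.1.1 - 1 : ℕ) : ℝ)) * (Real.exp ((c * (kGeo i).M * α₀) * ((((ℓ + 1 : ℕ) : ℝ) ^ s.1.1)⁻¹)) - 1))) ^ 2)
        * ∑ z ∈ Finset.univ.filter (fun z : SiteY i => blkOf i.D.toDomains z = s), ∑ a, ∑ b, ‖Φ z a b‖ ^ 2
      ≤ ∑ k ∈ Finset.univ.filter (fun k : RBond (toKT i).XB => blkOf i.D.toDomains (rsrc k) = s ∧ blkOf i.D.toDomains (rtgt k) = s),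
            ∑ a, ∑ b, ‖cdS i U k.1.2 Φ (rsrc k) a b‖ ^ 2
        + κ * ∑ a, ∑ b, ‖blkSumY i (parSymY i) U Φ s a b‖ ^ 2 := by
  obtain ⟨u, hu, hbond⟩ := exists_gauge_of_reg335_blk i hG hreg s
  set ρ : ℝ := Real.exp ((c * (kGeo i).M * α₀) * ((((ℓ + 1 : ℕ) : ℝ) ^ s.1.1)⁻¹)) - 1 with hρdef
  have hρ : 0 ≤ ρ := by
    rw [hρdef, sub_nonneg]
    exact Real.one_le_exp (mul_nonneg hC (inv_nonneg.2 (by positivity)))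
  -- the three letters of file 2 at the gauge `u` and the table `parSymY`
  have hg : ∀ z : SiteY i, blkOf i.D.toDomains z = s →
      ‖(gSiteY i u z : Matrix (Fin N) (Fin N) ℂ)‖ ≤ 1 ∧ ‖(((gSiteY i u z)⁻¹ : (Matrix (Fin N) (Fin N) ℂ)ˣ) : Matrix (Fin N) (Fin N) ℂ)‖ ≤ 1 :=
    fun z hz => hu _ (symm_mem_bigCube_of_blkOf i hz)
  have hV : ∀ k : RBond (toKT i).XB, blkOf i.D.toDomains (rsrc k) = s → blkOf i.D.toDomains (rtgt k) = s →
      ‖(UboxY i (gaugeY i u U) k.1.2 (rsrc k) : Matrix (Fin N) (Fin N) ℂ) - 1‖ ≤ ρ ∧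
        ‖(((UboxY i (gaugeY i u U) k.1.2 (rsrc k))⁻¹ : (Matrix (Fin N) (Fin N) ℂ)ˣ) : Matrix (Fin N) (Fin N) ℂ)‖ ≤ 1 := by
    intro k h1 h2
    have e : ((boxEquiv i.hN).symm (rsrc k)).shift k.1.2 = (boxEquiv i.hN).symm (rtgt k) :=
      (boxEquiv_symm_shiftY i k.1.2 (rsrc k)).symm.trans (congrArg ((boxEquiv i.hN).symm) (shiftY_rsrc_eq_rtgt i k))
    have h := hbond k.1.2 ((boxEquiv i.hN).symm (rsrc k)) (symm_mem_bigCube_of_blkOf i h1)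
      (by rw [e]; exact symm_mem_bigCube_of_blkOf i h2)
    exact ⟨h.1, h.2.2⟩
  have hP : ∀ z : SiteY i, blkOf i.D.toDomains z = s →
      ‖(parSymY i (gaugeY i u U) (blkCornerY i s) z : Matrix (Fin N) (Fin N) ℂ) - 1‖
          ≤ (((d + 1 : ℕ) : ℝ)) * (((((ℓ + 1) ^ s.1.1 - 1 : ℕ) : ℝ)) * ρ) ∧
        ‖(((parSymY i (gaugeY i u U) (blkCornerY i s) z)⁻¹ : (Matrix (Fin N) (Fin N) ℂ)ˣ) : Matrix (Fin N) (Fin N) ℂ)‖ ≤ 1 := by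
    intro z hz
    have hcz : toLex (blkCornerY i s).1 ≤ toLex z.1 := Pi.toLex_monotone fun μ => (coord_bounds_of_blkOf i hz μ).1
    rw [parSymY_of_le hcz]
    show ‖(parTaxiV (gaugeY i u U) ((boxEquiv i.hN).symm (blkCornerY i s)) ((boxEquiv i.hN).symm z) : Matrix (Fin N) (Fin N) ℂ) - 1‖ ≤ _ ∧
      ‖(((parTaxiV (gaugeY i u U) ((boxEquiv i.hN).symm (blkCornerY i s)) ((boxEquiv i.hN).symm z))⁻¹ : (Matrix (Fin N) (Fin N) ℂ)ˣ) :
        Matrix (Fin N) (Fin N) ℂ)‖ ≤ 1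
    have h1 : ‖(1 : Matrix (Fin N) (Fin N) ℂ)‖ ≤ 1 := norm_one.le
    have hδ : ∀ μ, ((((boxEquiv i.hN).symm z μ - (boxEquiv i.hN).symm (blkCornerY i s) μ).val : ℕ) : ℤ) = z.1 μ - (blkCornerY i s).1 μ :=
      fun μ => val_symm_sub_symm_corner i hz μ
    have hn' : (((ℓ + 1) ^ s.1.1 : ℕ) : ℤ) = ((ℓ : ℤ) + 1) ^ s.1.1 := by push_cast; ring
    have hhalf : ∀ μ, 2 * ((boxEquiv i.hN).symm z μ - (boxEquiv i.hN).symm (blkCornerY i s) μ).val ≤ (PV d ℓ i.m i.K hd hL).sitesPerDir 0 := by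
      intro μ
      have h2 := two_mul_side_le_N0 i s μ
      rw [i.hN μ] at h2
      have hzμ := (coord_bounds_of_blkOf i hz μ).2
      have := hδ μ
      zify at h2 ⊢
      rw [this]
      linarith
    have hm : ∀ μ, ((boxEquiv i.hN).symm z μ - (boxEquiv i.hN).symm (blkCornerY i s) μ).val ≤ (ℓ + 1) ^ s.1.1 - 1 := by
      intro μ
      have hzμ := (coord_bounds_of_blkOf i hz μ).2
      have := hδ μ
      have hn : 1 ≤ (ℓ + 1) ^ s.1.1 := Nat.one_le_pow _ _ (Nat.succ_pos ℓ)
      zify [hn]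
      rw [this]
      linarith
    have hbox : ∀ (μ : Fin (PV d ℓ i.m i.K hd hL).d) (y : Site (PV d ℓ i.m i.K hd hL) 0),
        (∀ ν, (y ν - (boxEquiv i.hN).symm (blkCornerY i s) ν).val ≤ ((boxEquiv i.hN).symm z ν - (boxEquiv i.hN).symm (blkCornerY i s) ν).val) →
        (y μ - (boxEquiv i.hN).symm (blkCornerY i s) μ).val < ((boxEquiv i.hN).symm z μ - (boxEquiv i.hN).symm (blkCornerY i s) μ).val →
        ‖(gaugeY i u U μ y : Matrix (Fin N) (Fin N) ℂ) - 1‖ ≤ ρ ∧ ‖(gaugeY i u U μ y : Matrix (Fin N) (Fin N) ℂ)‖ ≤ 1 ∧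
          ‖(((gaugeY i u U μ y)⁻¹ : (Matrix (Fin N) (Fin N) ℂ)ˣ) : Matrix (Fin N) (Fin N) ℂ)‖ ≤ 1 := by
      intro μ y hy hyμ
      have hyQ := mem_bigCube_of_box i hz hy μ 0 (by
        have := hm μ; have hn : 1 ≤ (ℓ + 1) ^ s.1.1 := Nat.one_le_pow _ _ (Nat.succ_pos ℓ); omega)
      have hy'Q := mem_bigCube_of_box i hz hy μ 1 (by
        have := hm μ; have hn : 1 ≤ (ℓ + 1) ^ s.1.1 := Nat.one_le_pow _ _ (Nat.succ_pos ℓ); omega)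
      have e0 : Function.update y μ (y μ + ((0 : ℕ) : ZMod ((PV d ℓ i.m i.K hd hL).sitesPerDir 0))) = y := by simp
      have e1 : Function.update y μ (y μ + ((1 : ℕ) : ZMod ((PV d ℓ i.m i.K hd hL).sitesPerDir 0))) = y.shift μ := by
        simp [Site.shift]
      rw [e0] at hyQ
      rw [e1] at hy'Q
      exact hbond μ y hyQ hy'Q
    have key := parTaxiV_near_one_of_box h1 hρ hhalf hm hbox
    have ed : (((PV d ℓ i.m i.K hd hL).d : ℕ) : ℝ) = ((d + 1 : ℕ) : ℝ) := rfl
    rw [ed] at key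
    exact ⟨key.1, key.2.2⟩
  have h := block_form_ge_of_gauge i u U (parSymY_isGaugeLawS i) hκ s hg hV hP Φ
  exact h

end Block

end Literature.MathematicalPhysics.QuantumFieldTheory.Balaban1983to89.B9Thm31SiteCoerciveReg335BlockY
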